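import Summits.BirchSwinnertonDyer.Rank1Residual.GaloisImage.CanonicalComparisonInverseGenerator
import Summits.BirchSwinnertonDyer.Rank1Residual.GaloisImage.KatoKuriharaPortThree
import Summits.BirchSwinnertonDyer.Rank1Residual.GaloisImage.CanonicalKolyvaginDatumAdmissiblePrimePow
import Summits.BirchSwinnertonDyer.Rank1Residual.GaloisImage.PrimeChoiceSakamoto
import Summits.BirchSwinnertonDyer.Rank1Residual.GaloisImage.PropagatedStructureUnramified
import Summits.BirchSwinnertonDyer.Rank1Residual.GaloisImage.SakamotoN11InstanceResidual
import HarnessLib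

/-!
# The universal-closure PORT `KatoKuriharaPortThreeAt W 0 v₃` is FALSE on every row carrying a UNIT
# Kurihara number at a `τ`-class level (cell `b2b-bsdres`, team n1011, seat p11 GEN 11; row
# T-PORT-NEG, file N2 — the kernel form of the ANOMALY `HOME/b2b-bsdres-n1011-p11/gen11/PORT-ANOMALY.md`;
# PORT keeper r1 GEN 47 CONFIRMED `cells/n1011/route1/g47_port_anomaly_check.md`; lead R5-110/111 (n3-α))

HONEST FRAMING (cell `b2b-bsdres`, run/shared/lean/b2b/bsd-rank1-residual/, verbatim in every
file): the goal of the cell is to DELETE the COMBINATION-SHAPED residual classes of the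
Birch–Swinnerton-Dyer formula for ALL analytic-rank `≤ 1` elliptic curves over `ℚ` — "full BSD
formula for every rank `≤ 1` curve in class `C`" assembled STRICTLY from published theorems — so
that the rank-`≤ 1` remainder becomes exactly the CONSTRUCTION-SHAPED classes, which are TYPED
(missing-input `Prop`s), NOT attempted. This is not "finishing BSD". Team n1011: research route on
the CONSTRUCTION-SHAPED class X4 / §I N11.  THIS IS A NEGATIVE RESULT ABOUT A CELL-TYPED PREDICATE:
it proves that the typed missing-input predicate `KatoKuriharaPortThreeAt W 0 v₃`
(`GaloisImage/KatoKuriharaPortThree.lean`, FLAG `K22-Thm3.13-PORT@3`, "to be ASSUMED by its consumer")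
is UNSATISFIABLE on an explicit sub-population of the rows it was typed for; it does NOT refute any
published statement, Kato's fact, the rider, the single-level dictionaries DICT3 / DICT3₁, THEOREM D
or any record's kernel content — it says that the tree files DISPLAYING
`hPort : KatoKuriharaPortThreeAt W 0 v₃` next to such a certificate display a false hypothesis there
(VACUOUS AS DISPLAYED, pending the re-key to the shared-`η` PORT′ `KatoKuriharaPortThreeAtWith`,
p18 lineage).  No definition, no named fact, no `sorry`; nothing is booked; no mark / label moves.

## The mechanism (memo PORT-ANOMALY.md; r1's check memo; the local half is file N1)

`KatoKuriharaPortThreeAt W t v₃` quantifies over ALL pairs of guarded canonical `τ`-data `(D, D′)`,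
the guard `IsCanonicalTauDatumThreeAt` asking `∃ η, HasCanonicalComparison … η` SEPARATELY, and
demands `KatoKuriharaDictionaryThreeAt₂`, whose clause (COMP) identifies the witnesses of the two
data on common levels.  Take `k = k′ = 0`, `red = id`, `D` canonical for primitive roots `η` and `D′`
canonical for `η⁻¹` on the SAME full `τ`-class `𝒫` (`FSComp.exists_kolyvaginDatum_hasCanonicalComparison_frobeniusClassPrimes`
takes `η` as an input; `Subgroup.zpowers_inv`).  Then (COMP) makes the Kolyvagin system `κ′` of
clause (I4) a Kolyvagin system for BOTH data; at a level `d` and a class prime `𝔮 ∉ d` the two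
`fs_rel`s read `D.fs_𝔮 (loc_𝔮 κ′_d) = loc^s_𝔮 κ′_{d𝔮} = D′.fs_𝔮 (loc_𝔮 κ′_d)` with
`loc_𝔮 κ′_d ∈ 𝓕_can(𝔮) = H¹_ur`; file N1 (`PortNeg.eq_zero_of_fs_eq_fs_of_hasCanonicalComparison_inv`:
the canonical maps for `η` and `η⁻¹` are NEGATIVES on `H¹_ur`, and `φ^{fs}` is injective there by the
admissibility of the canonical datum) forces `loc_𝔮 κ′_d = 0` for EVERY class prime `𝔮 ∉ d`;
Sakamoto's Cor. 5.5 (`PrimeChoice.infinite_setOf_mem_frobeniusClassPrimes_localization_ne_zero_three`: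
a non-zero class is seen by infinitely many class primes; (H.1)/(H.3) DERIVED from surj(3) by
`hasIrreducibleModPGaloisRep_of_hasSurjectiveModNGaloisRep` / `hH3_self_of_hasSurjectiveModNGaloisRep`)
gives `κ′_d = 0` at every level, (I4) gives `κ_d = 0` by strong induction on `d`, and the value clause
collapses to `0 = u_d · δ̃_{n(d)}(ψ_d)`: **under the PORT every Kurihara number at a `τ`-class level
vanishes mod 3** (`exists_kuriharaNumber_eq_zero_of_port`) — so ONE unit Kurihara number at a class
level (the END-m1 / END-m2 / BR / BlindA records' certificates; the unit rows' `[0]⁺` at `d = ∅`)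
refutes it (`not_katoKuriharaPortThreeAt_zero_of_kuriharaNumber_ne_zero`, `…_of_unit`).  Displayed
inputs: DICT3₂'s own antecedents (`Addv`, `3 ∤ c₃`, surj(3), `#E(ℚ₃)[3] = 1`, `v₃ ∣ 3`, a
parametrisation datum with `3 ∤ c_P` and the period transfer), a Sakamoto `τ` with (H.2) for `E[3]`,
a FINITE `S` outside which `E` is good and prime to `3`, the level `d ⊆ 𝒫` and its certificate; no
tower-surjectivity, no `[0]⁺ ≠ 0`, `r_an` does not enter.  REPAIR (planners / p18): PORT′ with ONE
`η` shared by `D` and `D′` — the sign mechanism cannot touch it.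
References: C.-H. Kim, AJM 148 (2026) §2.1.2, §2.2.2, Thm. 3.13, Thm. 1.9 (6) [Kim2022StructureSelmer];
B. Mazur, K. Rubin, Mem. AMS 799 (2004) Def. 1.2.2, Lemma 1.2.3, Thm. 3.2.4 [MazurRubin2004];
R. Sakamoto, JTNB 36 (2024) Def. 4.1, Cor. 5.5 [Sakamoto2024]; K. Rubin, PCMI 18 (2011) Def. 1.9.6 [Rubin2011].
-/

noncomputable section

open scoped Classical NumberField ContRepresentation
open Field NumberField IsDedekindDomain WeierstrassCurve
open Literature.NumberTheory.EllipticCurves Literature.NumberTheory.EllipticCurves.ModularForms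
open Literature.NumberTheory.EllipticCurves.Rank1Residual
open Literature.NumberTheory.GaloisRepresentations
open Literature.NumberTheory.GaloisRepresentations.DiscreteGaloisModule
open Literature.NumberTheory.GaloisCohomology
open Literature.NumberTheory.DiophantineGeometry.Dioph (ratModP)

namespace Summit.BirchSwinnertonDyer.Rank1Residual.GaloisImage.PortNeg

variable (W : WeierstrassCurve ℚ) [W.IsElliptic] [W.IsGloballyMinimal]

/-- Local notation: the depth-`0` module `E[3^0·3]` of the PORT, in its own spelling. -/
local notation3 "ρ₀" => WeierstrassCurve.torsionGaloisModule W (((3 : ℕ) : ℤ) ^ 0 * ((3 : ℕ) : ℤ))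


/-- **★★ UNDER THE PORT, EVERY KURIHARA NUMBER AT A `τ`-CLASS LEVEL VANISHES mod 3** (depth `0`,
`t = 0`; r1 GEN 47's reading (R-i)).  With the two canonical data `D` (over `η`) and `D′` (over
`η⁻¹`) on the full class fed to the PORT at `k = k′ = 0`, `red = id`: (COMP) makes the Kolyvagin
system `κ′` of (I4) a Kolyvagin system for BOTH data, so at every level `d` and every class prime
`q ∉ d` the two `fs_rel`'s give `D.fs_q (loc_q κ′_d) = loc^s_q κ′_{dq} = D′.fs_q (loc_q κ′_d)`, whence
`loc_q κ′_d = 0` (file N1 + admissibility); Sakamoto's Cor. 5.5 (`PrimeChoice.…_three`, (H.1)/(H.3)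
from surj(3)) then forces `κ′_d = 0` for every level, (I4) forces `κ_d = 0` by strong induction, and
the value clause reads `0 = u_d · δ̃_{n(d)}(ψ_d)` for the dictionary's own surjective `ψ_d`.
[cite: Kim2022StructureSelmer, §2.2.2 and Thm. 3.13] [cite: Sakamoto2024, Def. 4.1 and Cor. 5.5 (pp. 926, 929)]
[cite: MazurRubin2004, Lemma 1.2.3 and Thm. 3.2.4] -/
theorem exists_kuriharaNumber_eq_zero_of_port {v₃ : HeightOneSpectrum (𝓞 ℚ)}
    (hPort : KatoKuriharaPortThreeAt W 0 v₃)
    (hadd : haveI : Fact (Nat.Prime 3) := ⟨Nat.prime_three⟩; Addv W 3)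
    (hc3 : ¬ 3 ∣ (W.baseChange ℚ_[3]).localTamagawaNumber ℤ_[3])
    (hsurj : W.HasSurjectiveModNGaloisRep ((3 : ℕ) : ℤ))
    (ht : Nat.card {Q : (W.baseChange ℚ_[3]).toAffine.Point // (3 : ℕ) • Q = 0} = 3 ^ 0)
    (hv₃ : ((3 : ℕ) : 𝓞 ℚ) ∈ v₃.asIdeal)
    {N : ℕ} [NeZero N] (P : ModularParametrizationData W N) (hcP : ¬ ((3 : ℕ) : ℤ) ∣ P.maninConstant)
    (hper : ∃ u : ℚ, ‖(u : ℚ_[3])‖ = 1 ∧ W.realPeriodRat = u * plusPeriod P.f)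
    {τ : absoluteGaloisGroup ℚ} (hτμ : τ ∈ rootsOfUnityFixer ℚ (3 ^ (0 + 1)))
    (hτq : Nonempty (cokerSubOne ρ₀ τ ≃+ ZMod (3 ^ (0 + 1))))
    {S : Set (HeightOneSpectrum (𝓞 ℚ))} (hSfin : S.Finite)
    (hS : ∀ v ∉ S, W.HasGoodReductionAt v ∧ ((3 : ℕ) : 𝓞 ℚ) ∉ v.asIdeal)
    (d : Finset (HeightOneSpectrum (𝓞 ℚ))) (hd : (↑d : Set _) ⊆ frobeniusClassPrimes ρ₀ S τ (3 ^ (0 + 1))) :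
    ∃ ψ : (ℓ : ℕ) → (ZMod ℓ)ˣ →* Multiplicative (ZMod (3 ^ (0 + 1))),
      (∀ q ∈ d, Function.Surjective (ψ (Ideal.absNorm q.asIdeal))) ∧
      haveI : NeZero (∏ q ∈ d, Ideal.absNorm q.asIdeal) :=
        ⟨Finset.prod_ne_zero_iff.2 fun q _ h => q.ne_bot (Ideal.absNorm_eq_zero_iff.1 h)⟩
      kuriharaNumber P.f (3 ^ (0 + 1)) (∏ q ∈ d, Ideal.absNorm q.asIdeal) ψ = 0 := by
  haveI : Fact (Nat.Prime 3) := ⟨Nat.prime_three⟩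
  haveI : Finite (geomTorsion W (((3 : ℕ) : ℤ) ^ 0 * ((3 : ℕ) : ℤ))) :=
    Module.finite_of_finite (ZMod (3 ^ (0 + 1)))
  -- (H.1) and (H.3) for `E[3]` from surjectivity
  have hirr3 := hasIrreducibleModPGaloisRep_of_hasSurjectiveModNGaloisRep W 3 hsurj
  have hirr : ∀ A : AddSubgroup (geomTorsion W (((3 : ℕ) : ℤ) ^ 0 * ((3 : ℕ) : ℤ))),
      (∀ (s : absoluteGaloisGroup ℚ), ∀ m ∈ A, ρ₀ s m ∈ A) → A = ⊥ ∨ A = ⊤ :=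
    fun A hA => hirr3 A fun σ P hP => hA σ P hP
  have hH3 : ∀ f : contOneCocycles (ContinuousRep.toTopRep ρ₀),
      (∀ u : absoluteGaloisGroup ℚ, ρ₀ u = 1 → u ∈ rootsOfUnityFixer ℚ (3 ^ (0 + 1)) → f.1 u = 0) →
        oneCocycleClass (ContinuousRep.toTopRep ρ₀) f = 0 :=
    fun f hf => hH3_self_of_hasSurjectiveModNGaloisRep W 3 (by decide) hsurj f hf
  have hτq3 : Nonempty (cokerSubOne ρ₀ τ ≃+ ZMod 3) := by simpa using hτq
  -- the two canonical data over `η`, `η⁻¹` on the full class, fed to the PORT with `red = id`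
  have hgen : ∀ q : HeightOneSpectrum (𝓞 ℚ), ∃ g : (ZMod (Ideal.absNorm q.asIdeal))ˣ,
      Subgroup.zpowers g = ⊤ := fun q => by
    haveI : Fact (Ideal.absNorm q.asIdeal).Prime := ⟨FSComp.prime_absNorm_rat q⟩
    obtain ⟨g, hg⟩ := IsCyclic.exists_generator (α := (ZMod (Ideal.absNorm q.asIdeal))ˣ)
    exact ⟨g, (Subgroup.eq_top_iff' _).mpr hg⟩
  choose η hη using hgen
  obtain ⟨D, hP, hT, hD⟩ := FSComp.exists_kolyvaginDatum_hasCanonicalComparison_frobeniusClassPrimes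
    ρ₀ (3 ^ (0 + 1)) S hτμ hτq (cyclotomicTransverse ρ₀) η (fun q _ => hη q)
  obtain ⟨D', hP', hT', hD'⟩ := FSComp.exists_kolyvaginDatum_hasCanonicalComparison_frobeniusClassPrimes
    ρ₀ (3 ^ (0 + 1)) S hτμ hτq (cyclotomicTransverse ρ₀) (fun q => (η q)⁻¹)
    (fun q _ => by rw [Subgroup.zpowers_inv]; exact hη q)
  have hG : D.IsCanonicalTauDatumThreeAt W (0 + 0) 0 :=
    isCanonicalTauDatumThreeAt_of_primes_eq hS hτμ hτq hP hT hD
  have hG' : D'.IsCanonicalTauDatumThreeAt W (0 + 0) 0 :=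
    isCanonicalTauDatumThreeAt_of_primes_eq hS hτμ hτq hP' hT' hD'
  obtain ⟨κ, Λ, κ', κu, Λu, κu', hW, hW', hcomp⟩ := hPort 0 0 D D' ContIntertwiningMap.id hG hG' le_rfl
    (fun x => by simp only [Nat.sub_self, pow_zero, one_smul]; rfl) hadd hc3 hsurj ht hv₃ P hcP hper
  obtain ⟨-, ⟨hKS, hbr⟩, -, -, hval⟩ := hW
  obtain ⟨-, ⟨hKS', -⟩, -, -, -⟩ := hW'
  have hlevel : ∀ e : Finset (HeightOneSpectrum (𝓞 ℚ)), D.IsLevel e → D'.IsLevel e := fun e he => by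
    change (↑e : Set _) ⊆ D'.primes; rw [hP', ← hP]; exact he
  -- (COMP) with `red = id`: `κu′ = κ′` on the levels
  have hcomp' : ∀ e : Finset (HeightOneSpectrum (𝓞 ℚ)), D.IsLevel e → κu' e = κ' e := by
    intro e he
    have h := (hcomp e (hlevel e he) he).2
    rwa [IdPair.map_id_one_apply] at h
  have hadm : D.IsAdmissible :=
    FSComp.isAdmissible_of_hasCanonicalComparison_frobeniusClassPrimes_primePow ρ₀ 3 (0 + 1) S hτq hτμ
      hP hD
  -- STEP 1: `loc_q κ′_e = 0` for every level `e` and every class prime `q ∉ e`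
  have hloc : ∀ e : Finset (HeightOneSpectrum (𝓞 ℚ)), D.IsLevel e → ∀ q ∈ D.primes, q ∉ e →
      galoisCohomology.localization ρ₀ (Sum.inr q) 1 (κ' e) = 0 := by
    intro e he q hq hqe
    have hqF : q ∈ frobeniusClassPrimes ρ₀ S τ (3 ^ (0 + 1)) := hP ▸ hq
    have hq' : q ∈ D'.primes := hP' ▸ hqF
    have hgood := (hS q hqF.1).1
    have h3q := (hS q hqF.1).2
    set x := galoisCohomology.localization ρ₀ (Sum.inr q) 1 (κ' e) with hx_def
    have hx : x ∈ unramifiedSubgroup (GaloisRep.toLocal q ρ₀) 1 := by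
      rw [← propagatedSelmerStructure_inr_eq_unramifiedSubgroup W 3 0 h3q hgood]
      have h : x ∈ (propagatedSelmerStructure W 3 0).modify D.transverse ∅ ∅ e (Sum.inr q) :=
        (SelmerStructure.mem_selmerGroup_iff _ _).1 (hKS.mem_selmerGroup e he) (Sum.inr q)
      rwa [SelmerStructure.modify_inr_of_not_mem _ _ (Finset.notMem_empty q) (Finset.notMem_empty q)
        hqe] at h
    have h1 := hKS.fs_rel e he q hq hqe
    have h2 := hKS'.fs_rel e (hlevel e he) q hq' hqe
    rw [hcomp' _ (he.insert hq), hcomp' e he] at h2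
    have hE : D.fs q x = D'.fs q x := by
      change D.fsLocalization q (κ' e) = D'.fsLocalization q (κ' e)
      rw [← h1, ← h2]
    exact eq_zero_of_fs_eq_fs_of_hasCanonicalComparison_inv (by decide) hD hD' hq hq' hqF.2.2.1
      (hadm q hq).1 hx hE
  -- STEP 2: `κ′_e = 0` for every level `e` (prime choice: a non-zero class is seen by infinitely
  -- many class primes, but STEP 1 leaves only the primes of `e`)
  have hκ'0 : ∀ e : Finset (HeightOneSpectrum (𝓞 ℚ)), D.IsLevel e → κ' e = 0 := by
    intro e he
    by_contra hne
    have hinf := PrimeChoice.infinite_setOf_mem_frobeniusClassPrimes_localization_ne_zero_three ρ₀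
      (p := 3) le_rfl (N := 3 ^ (0 + 1)) (by norm_num) S hSfin hτq3 hirr hH3 (κ' e) (κ' e) (κ' e) hne
      hne hne
    refine hinf (Set.Finite.subset e.finite_toSet ?_)
    rintro q ⟨hqF, hq1, -, -⟩
    by_contra hqe
    exact hq1 (hloc e he q (hP ▸ hqF) hqe)
  -- STEP 3: `κ_e = 0` for every level `e` (strong induction through (I4))
  have hκ0 : ∀ e : Finset (HeightOneSpectrum (𝓞 ℚ)), D.IsLevel e → κ e = 0 := by
    intro e
    induction e using Finset.strongInduction with
    | H e ih =>
      intro he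
      have h := hbr e he
      have hcl : AddSubgroup.closure {y : galoisCohomology ρ₀ 1 | ∃ c : Finset (HeightOneSpectrum (𝓞 ℚ)),
          c ⊂ e ∧ y = κ c} ≤ ⊥ := by
        refine (AddSubgroup.closure_le _).2 ?_
        rintro y ⟨c, hc, rfl⟩
        exact (AddSubgroup.mem_bot).2 (ih c hc (fun v hv => he (Finset.mem_coe.2 (hc.1 (Finset.mem_coe.1 hv)))))
      have h0 := (AddSubgroup.mem_bot).1 (hcl h)
      rw [hκ'0 e he, zero_sub, neg_eq_zero] at h0
      exact h0
  -- STEP 4: the value clause at the level `d`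
  have hdD : D.IsLevel d := by change (↑d : Set _) ⊆ D.primes; rw [hP]; exact hd
  obtain ⟨u, ψ, hψ, hv⟩ := hval d hdD
  refine ⟨ψ, hψ, ?_⟩
  rw [hκ0 d hdD, map_zero, map_zero, pow_zero, mul_one] at hv
  exact (Units.mul_right_eq_zero u).mp hv.symm

/-- **★★★ THE UNIVERSAL-CLOSURE PORT IS FALSE ON EVERY ROW WITH A UNIT KURIHARA NUMBER AT A
`τ`-CLASS LEVEL: `¬ KatoKuriharaPortThreeAt W 0 v₃`** (r1 GEN 47 (R-i); lead R5-111 (n3-α)).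
Displayed: DICT3₂'s own antecedents on the row (`Addv W 3`, `3 ∤ c₃`, surj(3), `#E(ℚ₃)[3] = 1`,
`v₃ ∣ 3`, a parametrisation datum with `3 ∤ c_P` and the period transfer), a Sakamoto `τ` with (H.2)
for `E[3]`, a FINITE `S` outside which `E` is good and prime to `3`, a finite set `d` of `τ`-class
primes (the END-m1 / END-m2 records' levels `n = ∏ ℓ`: `KolyvaginPrimeFrobeniusClass`), and the UNIT
certificate `δ̃_{n(d)}(ψ) ≢ 0 (mod 3)` for every surjective choice `ψ` of discrete logarithms (one
choice suffices up to units, `exists_units_kuriharaNumber_eq_mul`).  (H.1)/(H.3) are derived from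
surj(3); no tower-surjectivity, no `[0]⁺ ≠ 0`, `r_an` does not enter.  Consequence (honest): every
END / record displaying `hPort : KatoKuriharaPortThreeAt W 0 v₃` next to such a certificate (the 41
Kurihara record files and their corollaries) is VACUOUS AS DISPLAYED; the repair is the shared-`η`
PORT′ (`KatoKuriharaPortThreeAtWith`, p18 lineage).
[cite: Kim2022StructureSelmer, §2.2.2, Thm. 3.13 and Thm. 1.9 (6)] [cite: Sakamoto2024, Cor. 5.5 (p. 929)]
[cite: MazurRubin2004, Lemma 1.2.3 and Thm. 3.2.4] -/
theorem not_katoKuriharaPortThreeAt_zero_of_kuriharaNumber_ne_zero {v₃ : HeightOneSpectrum (𝓞 ℚ)}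
    (hadd : haveI : Fact (Nat.Prime 3) := ⟨Nat.prime_three⟩; Addv W 3)
    (hc3 : ¬ 3 ∣ (W.baseChange ℚ_[3]).localTamagawaNumber ℤ_[3])
    (hsurj : W.HasSurjectiveModNGaloisRep ((3 : ℕ) : ℤ))
    (ht : Nat.card {Q : (W.baseChange ℚ_[3]).toAffine.Point // (3 : ℕ) • Q = 0} = 3 ^ 0)
    (hv₃ : ((3 : ℕ) : 𝓞 ℚ) ∈ v₃.asIdeal)
    {N : ℕ} [NeZero N] (P : ModularParametrizationData W N) (hcP : ¬ ((3 : ℕ) : ℤ) ∣ P.maninConstant)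
    (hper : ∃ u : ℚ, ‖(u : ℚ_[3])‖ = 1 ∧ W.realPeriodRat = u * plusPeriod P.f)
    {τ : absoluteGaloisGroup ℚ} (hτμ : τ ∈ rootsOfUnityFixer ℚ (3 ^ (0 + 1)))
    (hτq : Nonempty (cokerSubOne ρ₀ τ ≃+ ZMod (3 ^ (0 + 1))))
    {S : Set (HeightOneSpectrum (𝓞 ℚ))} (hSfin : S.Finite)
    (hS : ∀ v ∉ S, W.HasGoodReductionAt v ∧ ((3 : ℕ) : 𝓞 ℚ) ∉ v.asIdeal)
    (d : Finset (HeightOneSpectrum (𝓞 ℚ))) (hd : (↑d : Set _) ⊆ frobeniusClassPrimes ρ₀ S τ (3 ^ (0 + 1)))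
    (hcert : ∀ ψ : (ℓ : ℕ) → (ZMod ℓ)ˣ →* Multiplicative (ZMod (3 ^ (0 + 1))),
      (∀ q ∈ d, Function.Surjective (ψ (Ideal.absNorm q.asIdeal))) →
      haveI : NeZero (∏ q ∈ d, Ideal.absNorm q.asIdeal) :=
        ⟨Finset.prod_ne_zero_iff.2 fun q _ h => q.ne_bot (Ideal.absNorm_eq_zero_iff.1 h)⟩
      kuriharaNumber P.f (3 ^ (0 + 1)) (∏ q ∈ d, Ideal.absNorm q.asIdeal) ψ ≠ 0) :
    ¬ KatoKuriharaPortThreeAt W 0 v₃ := fun hPort => by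
  obtain ⟨ψ, hψ, h0⟩ := exists_kuriharaNumber_eq_zero_of_port W hPort hadd hc3 hsurj ht hv₃ P hcP hper
    hτμ hτq hSfin hS d hd
  exact hcert ψ hψ h0

/-- **★ THE UNIT ROWS (`d = ∅`): `¬ KatoKuriharaPortThreeAt W 0 v₃` from `[0]⁺ ≢ 0 (mod 3)`**
(`δ̃_1 = [0]⁺ mod 3`, `kuriharaNumber_one`) — the DICT3₁ / END-m1-unit-case population.
[cite: Kim2022StructureSelmer, Thm. 3.13] [cite: Sakamoto2024, Cor. 5.5 (p. 929)] -/
theorem not_katoKuriharaPortThreeAt_zero_of_unit {v₃ : HeightOneSpectrum (𝓞 ℚ)}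
    (hadd : haveI : Fact (Nat.Prime 3) := ⟨Nat.prime_three⟩; Addv W 3)
    (hc3 : ¬ 3 ∣ (W.baseChange ℚ_[3]).localTamagawaNumber ℤ_[3])
    (hsurj : W.HasSurjectiveModNGaloisRep ((3 : ℕ) : ℤ))
    (ht : Nat.card {Q : (W.baseChange ℚ_[3]).toAffine.Point // (3 : ℕ) • Q = 0} = 3 ^ 0)
    (hv₃ : ((3 : ℕ) : 𝓞 ℚ) ∈ v₃.asIdeal)
    {N : ℕ} [NeZero N] (P : ModularParametrizationData W N) (hcP : ¬ ((3 : ℕ) : ℤ) ∣ P.maninConstant)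
    (hper : ∃ u : ℚ, ‖(u : ℚ_[3])‖ = 1 ∧ W.realPeriodRat = u * plusPeriod P.f)
    {τ : absoluteGaloisGroup ℚ} (hτμ : τ ∈ rootsOfUnityFixer ℚ (3 ^ (0 + 1)))
    (hτq : Nonempty (cokerSubOne ρ₀ τ ≃+ ZMod (3 ^ (0 + 1))))
    {S : Set (HeightOneSpectrum (𝓞 ℚ))} (hSfin : S.Finite)
    (hS : ∀ v ∉ S, W.HasGoodReductionAt v ∧ ((3 : ℕ) : 𝓞 ℚ) ∉ v.asIdeal)
    (hunit : ratModP (3 ^ (0 + 1)) (ratPlusSymbol P.f 0) ≠ 0) :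
    ¬ KatoKuriharaPortThreeAt W 0 v₃ := by
  refine not_katoKuriharaPortThreeAt_zero_of_kuriharaNumber_ne_zero W hadd hc3 hsurj ht hv₃ P hcP hper
    hτμ hτq hSfin hS ∅ (by simp) fun ψ _ => ?_
  have hk : ∀ (n : ℕ) [NeZero n], n = 1 →
      kuriharaNumber P.f (3 ^ (0 + 1)) n ψ = ratModP (3 ^ (0 + 1)) (ratPlusSymbol P.f 0) := by
    rintro n _ rfl; exact kuriharaNumber_one P.f _ ψ
  haveI : NeZero (∏ q ∈ (∅ : Finset (HeightOneSpectrum (𝓞 ℚ))), Ideal.absNorm q.asIdeal) := ⟨by simp⟩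
  rw [hk (∏ q ∈ (∅ : Finset (HeightOneSpectrum (𝓞 ℚ))), Ideal.absNorm q.asIdeal) Finset.prod_empty]
  exact hunit

end Summit.BirchSwinnertonDyer.Rank1Residual.GaloisImage.PortNeg

end
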